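import Summits.ResolutionOfSingularities.ResolutionOfSingularities.Theorems.RadicialJungCleanModelsSufficeChartsPoint
import Summits.ResolutionOfSingularities.ResolutionOfSingularities.Theorems.RadicialJungCleanModelsSufficeChartsCompat
import Mathlib.Data.ZMod.Basic

/-!
# Route `RadicialJung`, crux `CleanModelsSuffice`, line `Sketch`: two toroidal Kato charts at a
# common point differ by units

Helper for the registered stub `stub_charts` of the skeleton of
`Summit.ResolutionOfSingularities.ResolutionOfSingularities.Theses.RadicialJung.CleanModelsSuffice`
(stmt-ResolutionOfSingularities-15883). For adapted data `D`, two toroidal charts `v`, `v'` and a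
point `w ∈ U v ∩ U v'`, OVERLAP (both ways) matches the charged sections of `v` and of `v'` that
vanish at `w` by a bijection `σ` (inverse `τ`) up to associatedness in `𝒪_{V,w}` — a bijection
because distinct members of a minimal system of generators are not associated (JOINTSOP,
`not_associated_of_ne`) — and makes the exponents proportional modulo `p`; after normalisation
(`a' ≡ c' · a`) the normalised exponents are proportional too (`a'₁ ≡ μ̃ a'₂ ∘ σ`, `μ̃` found with
a modular inverse). Feeding this to the arithmetic of `…ChartsCompat` and comparing `p`-th powers
(`…ChartsKummer`): every value of the Kummer chart of `v` at `w` is a unit multiple, in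
`integralClosure 𝒪_{V,w} L`, of a value of the Kummer chart of `v'` (`exists_associated_kci`).
-/

noncomputable section

set_option linter.dupNamespace false -- mandated namespace of this single-conjunct summit

open CategoryTheory AlgebraicGeometry TopologicalSpace
open Literature.AlgebraicGeometry.Resolution

namespace Summit.ResolutionOfSingularities.ResolutionOfSingularities.Theorems.RadicialJung.CleanModelsSuffice

attribute [local instance] stalkAlgebra isScalarTower_stalkAlgebra

namespace AdaptedData

variable {p : ℕ} {V : Scheme.{0}} [IsIntegral V] {L : Type} [Field L] [Algebra V.functionField L]
variable (D : AdaptedData p V L)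
variable (hNorm : ∀ {O K L : Type} [CommRing O] [IsDomain O] [Field K] [Algebra O K]
  [IsFractionRing O K] [Field L] [Algebra K L] [Algebra O L] [IsScalarTower O K L]
  (p : ℕ) (_ : p.Prime) [CharP K p] (_ : Module.finrank K L = p) (m : ℕ)
  (t : Fin (m + 1) → O) (_ : ∀ i, t i ≠ 0) (a : Fin (m + 1) → ℕ) (_ : ∀ i, ¬ p ∣ a i)
  (y : L) (_ : y ∉ Set.range (algebraMap K L))
  (_ : y ^ p = algebraMap O L (∏ i, t i ^ a i)),
  ∃ (y' : L) (a' : Fin (m + 1) → ℕ) (c : ℕ), y' ∉ Set.range (algebraMap K L) ∧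
    a' 0 = 1 ∧ (∀ i, 1 ≤ a' i ∧ a' i < p) ∧ ¬ p ∣ c ∧ (∀ i, a' i ≡ c * a i [MOD p]) ∧
    y' ^ p = algebraMap O L (∏ i, t i ^ a' i))
variable (hp : p.Prime) [CharP V.functionField p] (hdeg : Module.finrank V.functionField L = p)

/-! ## Matching the charged sections of two charts at a common point -/

omit [CharP V.functionField p] in
/-- **OVERLAP for charged indices**: a charged section of `v` vanishing at `w` is associated at
`w` to a charged section of `v'`, with proportional exponents. [folklore] -/
theorem exists_match (v : V) (hm : 0 < D.m v) (v' : V) (hm' : 0 < D.m v') (w : V) (hw : w ∈ D.U v)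
    (hw' : w ∈ D.U v') :
    ∃ μ : ℕ, ¬ p ∣ μ ∧ ∀ i : Fin (D.m v - 1 + 1),
      D.tw v hm w hw i ∈ IsLocalRing.maximalIdeal (V.presheaf.stalk w) →
      ∃ i' : Fin (D.m v' - 1 + 1), Associated (D.tw v hm w hw i) (D.tw v' hm' w hw' i') ∧
        D.aC v' hm' i' ≡ μ * D.aC v hm i [MOD p] := by
  obtain ⟨μ, hμ, h⟩ := D.overlap v v' w hw hw'
  refine ⟨μ, hμ, fun i hi => ?_⟩
  obtain ⟨i'', hassoc, hiff, hexp⟩ := h (D.cidx v hm i) hi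
  have hi1 : ((D.cidx v hm i : Fin (D.r v)) : ℕ) < D.m v := by
    have h1 := i.2; rw [coe_cidx]; omega
  have hi2 : (i'' : ℕ) < D.m v' := hiff.mp hi1
  have hi3 : (i'' : ℕ) < D.m v' - 1 + 1 := by omega
  refine ⟨⟨i'', hi3⟩, ?_, ?_⟩
  · have heq : D.cidx v' hm' ⟨i'', hi3⟩ = i'' := Fin.ext rfl
    change Associated _ (V.presheaf.germ (D.U v') w hw' (D.s v' (D.cidx v' hm' ⟨i'', hi3⟩)))
    rw [heq]
    exact hassoc
  · have h1 := hexp hi1 hi2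
    have e1 : (⟨(i'' : ℕ), hi2⟩ : Fin (D.m v')) = Fin.cast (D.sub_one_add_one hm') ⟨i'', hi3⟩ :=
      Fin.ext rfl
    have e2 : (⟨((D.cidx v hm i : Fin (D.r v)) : ℕ), hi1⟩ : Fin (D.m v)) =
        Fin.cast (D.sub_one_add_one hm) i := Fin.ext rfl
    rw [e1, e2] at h1
    exact h1

omit [CharP V.functionField p] in
/-- **Distinct charged sections of one chart vanishing at `w` are not associated at `w`**
(JOINTSOP and `not_associated_of_ne`). [folklore] -/
theorem eq_of_associated_tw (hVreg : Scheme.IsRegular V) (v : V) (hm : 0 < D.m v) (w : V)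
    (hw : w ∈ D.U v) (i j : Fin (D.m v - 1 + 1))
    (hi : D.tw v hm w hw i ∈ IsLocalRing.maximalIdeal (V.presheaf.stalk w))
    (hj : D.tw v hm w hw j ∈ IsLocalRing.maximalIdeal (V.presheaf.stalk w))
    (h : Associated (D.tw v hm w hw i) (D.tw v hm w hw j)) : i = j := by
  haveI : IsRegularLocalRing (V.presheaf.stalk w) := hVreg w
  obtain ⟨dw, tW, ι, hspan, hdim, htW, hinj⟩ := D.jointSop v w hw
  by_contra hne
  have hne' : ι (D.cidx v hm i) ≠ ι (D.cidx v hm j) := fun h' =>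
    hne (D.cidx_injective v hm (hinj _ _ hi hj h'))
  refine not_associated_of_ne dw tW hspan hdim hne' ?_
  rw [htW _ hi, htW _ hj]
  exact h

omit [IsIntegral V] [CharP V.functionField p] in
/-- Associated elements lie in `𝔪_w` together. [folklore] -/
theorem mem_of_associated {w : V} {x y : V.presheaf.stalk w} (h : Associated x y)
    (hx : x ∈ IsLocalRing.maximalIdeal (V.presheaf.stalk w)) :
    y ∈ IsLocalRing.maximalIdeal (V.presheaf.stalk w) := by
  rw [IsLocalRing.mem_maximalIdeal, mem_nonunits_iff] at hx ⊢
  rwa [← h.isUnit_iff]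

/-- **The matching data of two toroidal charts at a common point**, in the form consumed by
`exists_associated_weightMonomial`: mutually inverse `σ`, `τ` between the charged sections of
`v` and of `v'` vanishing at `w`, associatedness, and proportionality of the NORMALISED
exponents `a'₁ ≡ μ̃ · a'₂ ∘ σ (mod p)`. [folklore] -/
theorem exists_compatData (hVreg : Scheme.IsRegular V) (v : V) (hm : 0 < D.m v) (v' : V)
    (hm' : 0 < D.m v') (w : V) (hw : w ∈ D.U v) (hw' : w ∈ D.U v')
    (S₁ : Finset (Fin (D.m v - 1 + 1)))
    (hS₁ : ∀ i, i ∈ S₁ ↔ D.tw v hm w hw i ∈ IsLocalRing.maximalIdeal (V.presheaf.stalk w))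
    (S₂ : Finset (Fin (D.m v' - 1 + 1)))
    (hS₂ : ∀ i, i ∈ S₂ ↔ D.tw v' hm' w hw' i ∈ IsLocalRing.maximalIdeal (V.presheaf.stalk w)) :
    ∃ (σ : Fin (D.m v - 1 + 1) → Fin (D.m v' - 1 + 1)) (τ : Fin (D.m v' - 1 + 1) → Fin (D.m v - 1 + 1))
      (μ : ℕ), (∀ i ∈ S₁, σ i ∈ S₂ ∧ τ (σ i) = i ∧ Associated (D.tw v hm w hw i) (D.tw v' hm' w hw' (σ i)) ∧
        D.a' hNorm hp hdeg v hm i ≡ μ * D.a' hNorm hp hdeg v' hm' (σ i) [MOD p]) ∧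
      (∀ i' ∈ S₂, τ i' ∈ S₁ ∧ σ (τ i') = i') := by
  classical
  obtain ⟨μ, hμ, hmatch⟩ := D.exists_match v hm v' hm' w hw hw'
  obtain ⟨μ', -, hmatch'⟩ := D.exists_match v' hm' v hm w hw' hw
  -- the matchings as total functions
  let σ : Fin (D.m v - 1 + 1) → Fin (D.m v' - 1 + 1) := fun i =>
    if h : D.tw v hm w hw i ∈ IsLocalRing.maximalIdeal (V.presheaf.stalk w) then (hmatch i h).choose
    else 0
  let τ : Fin (D.m v' - 1 + 1) → Fin (D.m v - 1 + 1) := fun i' =>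
    if h : D.tw v' hm' w hw' i' ∈ IsLocalRing.maximalIdeal (V.presheaf.stalk w) then
      (hmatch' i' h).choose else 0
  have hσ : ∀ i (h : D.tw v hm w hw i ∈ IsLocalRing.maximalIdeal (V.presheaf.stalk w)),
      Associated (D.tw v hm w hw i) (D.tw v' hm' w hw' (σ i)) ∧
        D.aC v' hm' (σ i) ≡ μ * D.aC v hm i [MOD p] := by
    intro i h
    simp only [σ, dif_pos h]
    exact (hmatch i h).choose_spec
  have hτ : ∀ i' (h : D.tw v' hm' w hw' i' ∈ IsLocalRing.maximalIdeal (V.presheaf.stalk w)),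
      Associated (D.tw v' hm' w hw' i') (D.tw v hm w hw (τ i')) := by
    intro i' h
    simp only [τ, dif_pos h]
    exact (hmatch' i' h).choose_spec.1
  -- the multiplier for the normalised exponents
  obtain ⟨-, -, -, hc₁, hcong₁, -⟩ := D.normalized_spec hNorm hp hdeg v hm
  obtain ⟨-, -, -, hc₂, hcong₂, -⟩ := D.normalized_spec hNorm hp hdeg v' hm'
  have hcop : Nat.Coprime (D.c' hNorm hp hdeg v' hm' * μ) p :=
    ((Nat.Prime.coprime_iff_not_dvd hp).mpr fun h => (hp.dvd_mul.mp h).elim hc₂ hμ).symm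
  obtain ⟨lam, -, hlam⟩ := Nat.exists_mul_mod_eq_one_of_coprime hcop hp.one_lt
  refine ⟨σ, τ, D.c' hNorm hp hdeg v hm * lam, fun i hi => ?_, fun i' hi' => ?_⟩
  · have h := (hS₁ i).mp hi
    obtain ⟨hassoc, hexp⟩ := hσ i h
    have hmem₂ : σ i ∈ S₂ := (hS₂ _).mpr (mem_of_associated hassoc h)
    refine ⟨hmem₂, ?_, hassoc, ?_⟩
    · have h2 := (hS₂ _).mp hmem₂
      have hassoc' := hτ (σ i) h2
      have hmem₁ := mem_of_associated hassoc' h2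
      exact D.eq_of_associated_tw hVreg v hm w hw _ _ hmem₁ h (hassoc.trans hassoc').symm
    · have e1 := hcong₁ i
      have e2 := hcong₂ (σ i)
      have e4 : D.c' hNorm hp hdeg v' hm' * μ * lam ≡ 1 [MOD p] := by
        rw [Nat.ModEq, hlam, Nat.mod_eq_of_lt hp.one_lt]
      set c₁ := D.c' hNorm hp hdeg v hm
      set c₂ := D.c' hNorm hp hdeg v' hm'
      set A₁ := D.a' hNorm hp hdeg v hm i
      set A₂ := D.a' hNorm hp hdeg v' hm' (σ i)
      set C₁ := D.aC v hm i
      set C₂ := D.aC v' hm' (σ i)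
      rw [← ZMod.natCast_eq_natCast_iff] at e1 e2 hexp e4 ⊢
      push_cast at e1 e2 hexp e4 ⊢
      linear_combination e1 - ((c₁ : ZMod p) * lam) * e2 - ((c₁ : ZMod p) * lam * c₂) * hexp -
        ((c₁ : ZMod p) * C₁) * e4
  · have h2 := (hS₂ i').mp hi'
    have hassoc' := hτ i' h2
    have hmem₁ := mem_of_associated hassoc' h2
    refine ⟨(hS₁ _).mpr hmem₁, ?_⟩
    have hassoc'' := (hσ (τ i') hmem₁).1
    have hmemσ := mem_of_associated hassoc'' hmem₁
    exact D.eq_of_associated_tw hVreg v' hm' w hw' _ _ hmemσ h2 (hassoc'.trans hassoc'').symm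

/-! ## The two Kummer charts at `w` differ by units -/

/-- **Every value of the Kummer chart of `v` at `w` is a unit multiple, in
`integralClosure 𝒪_{V,w} L`, of a value of the Kummer chart of `v'`** (matching data, the weight
arithmetic of `exists_associated_weightMonomial`, and comparison of `p`-th powers). [folklore] -/
theorem exists_associated_kci (hVreg : Scheme.IsRegular V) (v : V) (hm : 0 < D.m v) (v' : V)
    (hm' : 0 < D.m v') (w : V) (hw : w ∈ D.U v) (hw' : w ∈ D.U v')
    (c : kummerMonoid p (D.a' hNorm hp hdeg v hm)) :
    ∃ c' : kummerMonoid p (D.a' hNorm hp hdeg v' hm'),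
      Associated (D.kci hNorm hp hdeg v hm w hw (Multiplicative.ofAdd c))
        (D.kci hNorm hp hdeg v' hm' w hw' (Multiplicative.ofAdd c')) := by
  classical
  set S₁ : Finset (Fin (D.m v - 1 + 1)) := Finset.univ.filter fun i =>
    D.tw v hm w hw i ∈ IsLocalRing.maximalIdeal (V.presheaf.stalk w) with hS₁def
  have hS₁ : ∀ i, i ∈ S₁ ↔ D.tw v hm w hw i ∈ IsLocalRing.maximalIdeal (V.presheaf.stalk w) :=
    fun i => by simp [hS₁def]
  set S₂ : Finset (Fin (D.m v' - 1 + 1)) := Finset.univ.filter fun i =>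
    D.tw v' hm' w hw' i ∈ IsLocalRing.maximalIdeal (V.presheaf.stalk w) with hS₂def
  have hS₂ : ∀ i, i ∈ S₂ ↔ D.tw v' hm' w hw' i ∈ IsLocalRing.maximalIdeal (V.presheaf.stalk w) :=
    fun i => by simp [hS₂def]
  obtain ⟨σ, τ, μ, hσ, hτ⟩ :=
    D.exists_compatData hNorm hp hdeg hVreg v hm v' hm' w hw hw' S₁ hS₁ S₂ hS₂
  obtain ⟨-, ha₂0, -, -, -, -⟩ := D.normalized_spec hNorm hp hdeg v' hm'
  obtain ⟨c', hc', hXY⟩ := exists_associated_weightMonomial p (D.tw v hm w hw)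
    (D.a' hNorm hp hdeg v hm) (D.tw v' hm' w hw') (D.a' hNorm hp hdeg v' hm') ha₂0 S₁ hS₁ S₂ hS₂
    σ τ μ hσ hτ c c.2
  refine ⟨⟨c', hc'⟩, ?_⟩
  obtain ⟨u, hu⟩ := hXY
  refine (associated_of_pow_eq_unit_mul_pow p hp.pos _ _ (u : V.presheaf.stalk w) u.isUnit ?_).symm
  rw [D.coe_kci_pow, D.coe_kci_pow]
  change algebraMap (V.presheaf.stalk w) L (∏ i, D.tw v' hm' w hw' i ^
      (kummerWeight p (D.a' hNorm hp hdeg v' hm') c' i).toNat) =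
    algebraMap (V.presheaf.stalk w) L u * algebraMap (V.presheaf.stalk w) L
      (∏ i, D.tw v hm w hw i ^ (kummerWeight p (D.a' hNorm hp hdeg v hm) c i).toNat)
  rw [← hu, map_mul, mul_comm]

end AdaptedData

/-- Associated germs lie in the maximal ideal together (explicit-binder form, the registered
interface of this helper file). [folklore] -/
theorem stalk_mem_maximalIdeal_of_associated (V : Scheme.{0}) (w : V) (x y : V.presheaf.stalk w)
    (h : Associated x y) (hx : x ∈ IsLocalRing.maximalIdeal (V.presheaf.stalk w)) :
    y ∈ IsLocalRing.maximalIdeal (V.presheaf.stalk w) :=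
  AdaptedData.mem_of_associated h hx

end Summit.ResolutionOfSingularities.ResolutionOfSingularities.Theorems.RadicialJung.CleanModelsSuffice

end
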